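import Summits.NavierStokesRegularity.NavierStokesRegularity.Theorems.TerminalTraceTypeITraceScarL3ExteriorIrrotationalConfined
import Literature.Analysis.FluidPDE.AncientLimitVanishing
import Literature.Analysis.FluidPDE.LocalTypeI
import HarnessLib

/-!
# The strip representative of an extinct Type-I apex, and Stub C ⇐ C1′ (the vorticity cut in its
# classical form) — item `TerminalTrace.TypeITraceScarL3`, stmt-NavierStokesRegularity-18385

Seat ns-typeII-p3 g9 (cell ns-regularity-ideate), `--supports stmt-NavierStokesRegularity-18385` (helper;
nsreg-p2 ROUND-25 seeds s25-3 / s25-6).  C2 of the vorticity cut is in the tree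
(`confined_of_exterior_irrotational`, `no_spreadExtinctApex_of_C1`); this file removes from C1 the burden
of CONSTRUCTING a representative, so that the open statement becomes a pure uniqueness claim about smooth,
bounded, divergence-free fields whose vorticity satisfies the ESS differential inequality:

* `ae_norm_le_strip_of_rate` — the rate `‖U(s,y)‖ ≤ C/√(−s)` (a.e. `y`, every `s < 0`) of the apex
  package, a slice-wise statement, gives the space–time bound `‖U‖ ≤ |C|/√(−b)` a.e. on every strip
  `]a, b[ × ℝ³`, `b < 0` (Fubini through a strongly measurable modification; measurability of `U` below
  `t = 0` comes from the suitable-weak-solution clause).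
* `exists_strip_representative_of_apex` — on every strip `]a, b[ × ℝ³`, `b < 0`, an extinct Type-I apex
  `(U, P)` (suitable in every `Q(a)`, plain pressure bound `D(z₀, r) ≤ D₀`, the rate) has the ESS
  representative of the tree (`exists_representative_of_ae_bound_of_local_pressure`, ESS 2003 §3
  (3.26)–(3.30)): `V = U` a.e. on the strip, jointly continuous, `C^∞` slices with all derivatives jointly
  continuous and `‖Dⁿ_x V‖ ≤ K` (`n ≤ 4`), a distributional Navier–Stokes solution with the same pressure,
  CLASSICALLY DIVERGENCE FREE, with vorticity `ω = curl V` of class `C¹` obeying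
  `|∂ₛω − Δω| ≤ 2K(|ω| + |∇ω|)` on the strip (`vorticity_c12_of_isDistributionalNSSolutionOn`,
  `vorticity_carleman_inequality`).
* `no_spreadExtinctApex_of_C1'` — **Stub C ⇐ C1′**, where C1′ is C1 with the representative GIVEN: «for
  every six-clause apex package which is SPREAD there are `δ, R > 0` such that for every `ε ∈ ]0, δ[`,
  EVERY field `V` that agrees with `U` a.e. on `]−δ,−ε[ × ℝ³`, is jointly continuous there with `C^∞`
  slices and classically divergence free, has `curl V(s, ·) = 0` on `{‖x‖ > R}` for `s ∈ ]−δ,−ε[`».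
  Proof: the strip representative exists by the previous theorem, C1′ makes it irrotationnal outside
  `B_R`, C2 (`confined_of_exterior_irrotational`) makes the apex confined — contradicting spreadness.

WHAT THIS IS NOT: not C1/C1′ (OPEN: NS-specific exterior backward uniqueness with Type-I coefficients —
the strip bound `K = K(ε)` blows up as `ε → 0`, which is where abstract backward uniqueness fails, R24),
not Stub C, not NS regularity.  [folklore; EscauriazaSereginSverak2003 §3 (3.26)–(3.32); Seregin2014 §6.6]
-/

noncomputable section

set_option linter.dupNamespace false

namespace Summit.NavierStokesRegularity.NavierStokesRegularity.Theorems.TypeITraceScarL3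

open MeasureTheory Set Function Filter Topology Metric InnerProductSpace
open Literature.Analysis.FluidPDE
open scoped NNReal ENNReal RealInnerProductSpace Laplacian ContDiff

/-! ### From the slice-wise rate to a space–time bound on strips -/

/-- **The rate gives a space–time `L^∞` bound on every strip below the top time.**  If `(U, P)` is a
suitable weak solution in every `Q(a)` (used only for the measurability of `U` below `t = 0`) and
`‖U(s, y)‖ ≤ C/√(−s)` for a.e. `y`, every `s < 0`, then `‖U‖ ≤ |C|/√(−b)` a.e. on `]a, b[ × ℝ³` for
every `b < 0` (Fubini through a strongly measurable modification of `U`). [folklore] -/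
theorem ae_norm_le_strip_of_rate
    {U : ℝ → EuclideanSpace ℝ (Fin 3) → EuclideanSpace ℝ (Fin 3)}
    {P : ℝ → EuclideanSpace ℝ (Fin 3) → ℝ}
    (hsw : ∀ a : ℝ, 0 < a →
      IsSuitableWeakSolutionInBall a (0 : ℝ × EuclideanSpace ℝ (Fin 3)) U P)
    {C : ℝ} (hrate : ∀ s : ℝ, s < 0 →
      ∀ᵐ y : EuclideanSpace ℝ (Fin 3), ‖U s y‖ ≤ C / Real.sqrt (-s))
    {a b : ℝ} (hb : b < 0) :
    ∀ᵐ z ∂(volume.restrict (Ioo a b ×ˢ (univ : Set (EuclideanSpace ℝ (Fin 3))))),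
      ‖U z.1 z.2‖ ≤ |C| / Real.sqrt (-b) := by
  set I : Set ℝ := Ioo a b with hIdef
  set L : ℝ := |C| / Real.sqrt (-b) with hLdef
  -- ### measurability of `uncurry U` on the strip (it lies below `t = 0`, in the union of the `Q(n+1)`)
  have hcov : I ×ˢ (univ : Set (EuclideanSpace ℝ (Fin 3))) ⊆
      ⋃ n : ℕ, parabolicCylinder ((n : ℝ) + 1) (0 : ℝ × EuclideanSpace ℝ (Fin 3)) := by
    rintro ⟨s, x⟩ ⟨hs, -⟩
    obtain ⟨n, hn⟩ := exists_nat_gt (‖x‖ + |a|)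
    refine mem_iUnion.2 ⟨n, ?_⟩
    rw [mem_parabolicCylinder]
    simp only [Prod.fst_zero, Prod.snd_zero, zero_sub, dist_zero_right]
    have hn0 : (0 : ℝ) ≤ n := Nat.cast_nonneg _
    have h1 : |a| < (n : ℝ) + 1 := by linarith [norm_nonneg x]
    have h2 : -a ≤ |a| := neg_le_abs a
    have h3 : ((n : ℝ) + 1) ≤ ((n : ℝ) + 1) ^ 2 := by nlinarith
    refine ⟨⟨by linarith [hs.1], hs.2.trans hb⟩, by linarith [abs_nonneg a]⟩
  have hmeas : AEStronglyMeasurable (uncurry U)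
      (volume.restrict (I ×ˢ (univ : Set (EuclideanSpace ℝ (Fin 3))))) := by
    have h : AEStronglyMeasurable (uncurry U) (volume.restrict
        (⋃ n : ℕ, parabolicCylinder ((n : ℝ) + 1) (0 : ℝ × EuclideanSpace ℝ (Fin 3)))) := by
      refine aestronglyMeasurable_iUnion_iff.2 fun n => ?_
      have hn : (0 : ℝ) < n + 1 := by positivity
      obtain ⟨G, hG, -, -⟩ := (hsw _ hn).1.localEnergy
      have := hG.locallyIntegrableOn.aestronglyMeasurable
      simpa using this
    exact h.mono_measure (Measure.restrict_mono hcov le_rfl)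
  -- ### a strongly measurable modification and its super-level set
  set g : ℝ × EuclideanSpace ℝ (Fin 3) → EuclideanSpace ℝ (Fin 3) := hmeas.mk (uncurry U) with hgdef
  have hfg : uncurry U =ᵐ[volume.restrict (I ×ˢ (univ : Set (EuclideanSpace ℝ (Fin 3))))] g :=
    hmeas.ae_eq_mk
  have hgm : StronglyMeasurable g := hmeas.stronglyMeasurable_mk
  have hB : MeasurableSet {z : ℝ × EuclideanSpace ℝ (Fin 3) | L < ‖g z‖} :=
    measurableSet_lt measurable_const hgm.norm.measurable
  -- slices of `g` agree with slices of `U` at a.e. time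
  have hslice : ∀ᵐ s ∂(volume.restrict I), ∀ᵐ y ∂(volume : Measure (EuclideanSpace ℝ (Fin 3))),
      g (s, y) = U s y := by
    have h1 : ∀ᵐ z ∂((volume.restrict I).prod (volume : Measure (EuclideanSpace ℝ (Fin 3)))),
        g z = uncurry U z := by
      rw [Measure.restrict_prod_eq_prod_univ, ← Measure.volume_eq_prod]; exact hfg.symm
    filter_upwards [Measure.ae_ae_of_ae_prod h1] with s hs using hs
  -- the super-level set is null (its slices are null by the rate)
  have hnull : (volume.restrict (I ×ˢ (univ : Set (EuclideanSpace ℝ (Fin 3)))))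
      {z : ℝ × EuclideanSpace ℝ (Fin 3) | L < ‖g z‖} = 0 := by
    rw [Measure.volume_eq_prod, ← Measure.restrict_prod_eq_prod_univ, Measure.measure_prod_null hB]
    filter_upwards [ae_restrict_mem measurableSet_Ioo, hslice] with s hs hgs
    have hsb : s < 0 := hs.2.trans hb
    show volume (Prod.mk s ⁻¹' {z : ℝ × EuclideanSpace ℝ (Fin 3) | L < ‖g z‖}) = 0
    rw [measure_eq_zero_iff_ae_notMem]
    filter_upwards [hrate s hsb, hgs] with y hy hgy
    simp only [mem_preimage, mem_setOf_eq, not_lt, hgy]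
    have hsqrt : Real.sqrt (-b) ≤ Real.sqrt (-s) := Real.sqrt_le_sqrt (by linarith [hs.2])
    calc ‖U s y‖ ≤ C / Real.sqrt (-s) := hy
      _ ≤ |C| / Real.sqrt (-s) := div_le_div_of_nonneg_right (le_abs_self C) (Real.sqrt_nonneg _)
      _ ≤ |C| / Real.sqrt (-b) :=
          div_le_div_of_nonneg_left (abs_nonneg C) (Real.sqrt_pos.2 (by linarith)) hsqrt
  -- ### conclusion
  have hae : ∀ᵐ z ∂(volume.restrict (I ×ˢ (univ : Set (EuclideanSpace ℝ (Fin 3))))),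
      z ∉ {z : ℝ × EuclideanSpace ℝ (Fin 3) | L < ‖g z‖} := measure_eq_zero_iff_ae_notMem.1 hnull
  filter_upwards [hae, hfg] with z hz hzg
  have h1 : ‖U z.1 z.2‖ = ‖g z‖ := by rw [← hzg]; rfl
  rw [h1]
  simpa only [mem_setOf_eq, not_lt] using hz

/-! ### The strip representative -/

/-- **The ESS strip representative of an extinct Type-I apex.**  Let `(U, P)` be suitable in every
`Q(a)`, with plain pressure bound `D(z₀, r) ≤ D₀` (`z₀.1 ≤ 0`, `r > 0`) and the rate
`‖U(s, y)‖ ≤ C/√(−s)`.  On every strip `Ω = ]a, b[ × ℝ³` with `b < 0` there are `K` and a field `V` with: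
`V = U` a.e. on `Ω`; `V` jointly continuous on `Ω`; `C^∞` slices, all spatial derivatives jointly
continuous, `‖Dⁿ_x V‖ ≤ K` for `n ≤ 4`; `(V, P)` a distributional Navier–Stokes solution on `Ω`; `V`
CLASSICALLY divergence free on `Ω`; and the vorticity `ω = curl V` is `C¹` on `Ω` with the ESS
differential inequality `|∂ₛω − Δω| ≤ 2K(|ω| + |∇ω|)`.  (ESS 2003 §3 (3.26)–(3.32) via the tree's
`exists_representative_of_ae_bound_of_local_pressure`, `vorticity_c12_of_isDistributionalNSSolutionOn`,
`vorticity_carleman_inequality`; the velocity bound on `]a − 1, b[ × ℝ³` is `ae_norm_le_strip_of_rate`.)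
[cite: EscauriazaSereginSverak2003, §3 (3.26)–(3.32)] -/
theorem exists_strip_representative_of_apex
    {U : ℝ → EuclideanSpace ℝ (Fin 3) → EuclideanSpace ℝ (Fin 3)}
    {P : ℝ → EuclideanSpace ℝ (Fin 3) → ℝ}
    (hsw : ∀ a : ℝ, 0 < a →
      IsSuitableWeakSolutionInBall a (0 : ℝ × EuclideanSpace ℝ (Fin 3)) U P)
    {D₀ : ℝ≥0}
    (hD : ∀ z₀ : ℝ × EuclideanSpace ℝ (Fin 3), z₀.1 ≤ 0 → ∀ r : ℝ, 0 < r → cknD r z₀ P ≤ D₀)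
    {C : ℝ} (hrate : ∀ s : ℝ, s < 0 →
      ∀ᵐ y : EuclideanSpace ℝ (Fin 3), ‖U s y‖ ≤ C / Real.sqrt (-s))
    {a b : ℝ} (hb : b < 0) :
    ∃ (K : ℝ) (V : ℝ → EuclideanSpace ℝ (Fin 3) → EuclideanSpace ℝ (Fin 3)),
      uncurry V =ᵐ[volume.restrict (Ioo a b ×ˢ (univ : Set (EuclideanSpace ℝ (Fin 3))))] uncurry U ∧
      ContinuousOn (uncurry V) (Ioo a b ×ˢ (univ : Set (EuclideanSpace ℝ (Fin 3)))) ∧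
      (∀ z ∈ Ioo a b ×ˢ (univ : Set (EuclideanSpace ℝ (Fin 3))), ContDiffAt ℝ (⊤ : ℕ∞) (V z.1) z.2) ∧
      (∀ n : ℕ, ContinuousOn
        (fun z : ℝ × EuclideanSpace ℝ (Fin 3) => iteratedFDeriv ℝ n (V z.1) z.2)
        (Ioo a b ×ˢ (univ : Set (EuclideanSpace ℝ (Fin 3))))) ∧
      (∀ n ≤ 4, ∀ z ∈ Ioo a b ×ˢ (univ : Set (EuclideanSpace ℝ (Fin 3))),
        ‖iteratedFDeriv ℝ n (V z.1) z.2‖ ≤ K) ∧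
      IsDistributionalNSSolutionOn ⟨Ioo a b ×ˢ (univ : Set (EuclideanSpace ℝ (Fin 3))),
        isOpen_Ioo.prod isOpen_univ⟩ 1 0 V P ∧
      (∀ z ∈ Ioo a b ×ˢ (univ : Set (EuclideanSpace ℝ (Fin 3))),
        VectorCalculus.divergence (V z.1) z.2 = 0) ∧
      ContDiffOn ℝ 1 (uncurry (vorticity V)) (Ioo a b ×ˢ (univ : Set (EuclideanSpace ℝ (Fin 3)))) ∧
      (∀ z ∈ Ioo a b ×ˢ (univ : Set (EuclideanSpace ℝ (Fin 3))),
        ‖Carleman.dt (uncurry (vorticity V)) z - Carleman.lap (uncurry (vorticity V)) z‖ ≤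
          (K + K) * (‖uncurry (vorticity V) z‖ +
            Real.sqrt (Carleman.gradSq (uncurry (vorticity V)) z))) := by
  set I : Set ℝ := Ioo a b with hIdef
  have hIo : IsOpen I := isOpen_Ioo
  set Ω : Set (ℝ × EuclideanSpace ℝ (Fin 3)) := I ×ˢ (univ : Set (EuclideanSpace ℝ (Fin 3))) with hΩdef
  have hΩo : IsOpen Ω := hIo.prod isOpen_univ
  -- ### the local pressure bound on unit cylinders
  have hP : ∀ z₀ : ℝ × EuclideanSpace ℝ (Fin 3), z₀.1 ≤ 0 →
      ∫⁻ q in parabolicCylinder 1 z₀, ‖P q.1 q.2‖ₑ ^ (3 / 2 : ℝ) ≤ D₀ := by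
    intro z₀ hz₀
    have h := hD z₀ hz₀ 1 one_pos
    simpa [cknD] using h
  -- ### the velocity bound on `]a - 1, b[ × ℝ³`
  have hbd : ∀ᵐ z ∂(volume.restrict (Ioo (a - 4 * (1 / 2 : ℝ) ^ 2) b ×ˢ
      (univ : Set (EuclideanSpace ℝ (Fin 3))))), ‖U z.1 z.2‖ ≤ |C| / Real.sqrt (-b) :=
    ae_norm_le_strip_of_rate hsw hrate hb
  -- ### the representative
  obtain ⟨K, V, hVU, hVc, hCD, hjc, hbdK⟩ := exists_representative_of_ae_bound_of_local_pressure
    hsw hP (S := univ) (S' := univ) isOpen_univ (ρ := 1 / 2) (by norm_num) (by norm_num) hb.le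
    (fun x _ => subset_univ _) hbd
  -- ### the equations hold for the representative
  have hsolU : IsDistributionalNSSolutionOn ⟨Ω, hΩo⟩ 1 0 U P :=
    isDistributionalNSSolutionOn_of_forall_cylinder (fun a' ha' => (hsw a' ha').1.distributional)
      hΩo (prod_mono (fun s hs => hs.2.trans hb) Subset.rfl)
  have hsol : IsDistributionalNSSolutionOn ⟨Ω, hΩo⟩ 1 0 V P :=
    hsolU.congr_ae hVU.symm (ae_of_all _ fun _ => rfl)
  have hU4 : ∀ t ∈ I, ContDiffOn ℝ 4 (V t) (univ : Set (EuclideanSpace ℝ (Fin 3))) :=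
    fun t ht x _ =>
      ((hCD (t, x) ⟨ht, mem_univ _⟩).of_le (by norm_cast)).contDiffWithinAt
  have hΦ : ∀ n ≤ 4, ContinuousOn
      (fun z : ℝ × EuclideanSpace ℝ (Fin 3) => iteratedFDeriv ℝ n (V z.1) z.2) Ω := fun n _ => hjc n
  have hK₀ : ∀ z ∈ Ω, ‖V z.1 z.2‖ ≤ K := fun z hz => by
    have h := hbdK 0 (by norm_num) z hz
    rwa [norm_iteratedFDeriv_zero] at h
  have hK₁ : ∀ z ∈ Ω, ‖fderiv ℝ (V z.1) z.2‖ ≤ K := fun z hz => by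
    have h := hbdK 1 (by norm_num) z hz
    rwa [norm_iteratedFDeriv_one] at h
  obtain ⟨hdiv, -, -, hω1, -⟩ :=
    vorticity_c12_of_isDistributionalNSSolutionOn hIo isOpen_univ hsol hU4 hΦ
  obtain ⟨-, -, hineq⟩ := vorticity_carleman_inequality hIo isOpen_univ hsol hU4 hΦ hK₀ hK₁
  exact ⟨K, V, hVU, hVc, hCD, hjc, hbdK, hsol, hdiv, hω1, hineq⟩

/-! ### Stub C ⇐ C1′ -/

/-- **«Stub C ⇐ C1′»** — the vorticity cut with the representative supplied.  C1′: for every six-clause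
extinct Type-I apex package which is SPREAD there are `δ, R > 0` such that for every `ε ∈ ]0, δ[`, every
field `V` agreeing with `U` a.e. on the strip `]−δ,−ε[ × ℝ³`, jointly continuous there with `C^∞` slices
and classically divergence free, satisfies `curl V(s, ·)(x) = 0` for `s ∈ ]−δ,−ε[`, `‖x‖ > R`.  THEN the
statement of Stub C `stub_no_spreadExtinctApex` holds: the strip representative
(`exists_strip_representative_of_apex`) is irrotational outside `B_R` by C1′, so the apex is confined by
C2 (`confined_of_exterior_irrotational`), contradicting spreadness.  C1′ is OPEN (the NS-specific
exterior backward uniqueness question with Type-I coefficients, nsreg-p2 ROUND-25 s25-3).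
[folklore; EscauriazaSereginSverak2003 §3–§5; Seregin2014 §6.6] -/
theorem no_spreadExtinctApex_of_C1'
    (hC1 : ∀ (U : ℝ → EuclideanSpace ℝ (Fin 3) → EuclideanSpace ℝ (Fin 3))
      (P : ℝ → EuclideanSpace ℝ (Fin 3) → ℝ)
      (G : ℝ → EuclideanSpace ℝ (Fin 3) →
        EuclideanSpace ℝ (Fin 3) →L[ℝ] EuclideanSpace ℝ (Fin 3))
      (M D₀ : ℝ≥0) (C : ℝ),
      (∀ a : ℝ, 0 < a →
        IsSuitableWeakSolutionInBall a (0 : ℝ × EuclideanSpace ℝ (Fin 3)) U P) →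
      (∀ a : ℝ, 0 < a →
        HasWeakSpatialGradientOn
          (parabolicCylinderOpens a (0 : ℝ × EuclideanSpace ℝ (Fin 3))) U G) →
      (∀ a : ℝ, 0 < a →
        typeIBound (parabolicCylinder a (0 : ℝ × EuclideanSpace ℝ (Fin 3))) U P G ≤ M) →
      (∀ z₀ : ℝ × EuclideanSpace ℝ (Fin 3), z₀.1 ≤ 0 →
        ∀ r : ℝ, 0 < r → cknD r z₀ P ≤ D₀) →
      (∀ s : ℝ, s < 0 →
        ∀ᵐ y : EuclideanSpace ℝ (Fin 3), ‖U s y‖ ≤ C / Real.sqrt (-s)) →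
      (∀ φ : EuclideanSpace ℝ (Fin 3) → EuclideanSpace ℝ (Fin 3),
        ContDiff ℝ (⊤ : ℕ∞) φ →
        HasCompactSupport φ → ∀ ε : ℝ, 0 < ε →
        ∃ s₀ : ℝ, s₀ < 0 ∧ ∀ᵐ s ∂(volume.restrict (Ioo s₀ 0)), |∫ y, ⟪U s y, φ y⟫| ≤ ε) →
      (∀ δ : ℝ, 0 < δ → ∀ R K : ℝ,
        ¬ (∀ᵐ z ∂(volume.restrict
          (Ioo (-δ) 0 ×ˢ (closedBall (0 : EuclideanSpace ℝ (Fin 3)) R)ᶜ)), ‖U z.1 z.2‖ ≤ K)) →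
      ∃ δ : ℝ, 0 < δ ∧ ∃ R : ℝ, 0 < R ∧ ∀ ε : ℝ, 0 < ε → ε < δ →
        ∀ V : ℝ → EuclideanSpace ℝ (Fin 3) → EuclideanSpace ℝ (Fin 3),
          uncurry V =ᵐ[volume.restrict
            (Ioo (-δ) (-ε) ×ˢ (univ : Set (EuclideanSpace ℝ (Fin 3))))] uncurry U →
          ContinuousOn (uncurry V) (Ioo (-δ) (-ε) ×ˢ (univ : Set (EuclideanSpace ℝ (Fin 3)))) →
          (∀ z ∈ Ioo (-δ) (-ε) ×ˢ (univ : Set (EuclideanSpace ℝ (Fin 3))),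
            ContDiffAt ℝ (⊤ : ℕ∞) (V z.1) z.2) →
          (∀ z ∈ Ioo (-δ) (-ε) ×ˢ (univ : Set (EuclideanSpace ℝ (Fin 3))),
            VectorCalculus.divergence (V z.1) z.2 = 0) →
          ∀ s ∈ Ioo (-δ) (-ε), ∀ x : EuclideanSpace ℝ (Fin 3), R < ‖x‖ → curl (V s) x = 0) :
    ∀ (U : ℝ → EuclideanSpace ℝ (Fin 3) → EuclideanSpace ℝ (Fin 3))
      (P : ℝ → EuclideanSpace ℝ (Fin 3) → ℝ)
      (G : ℝ → EuclideanSpace ℝ (Fin 3) →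
        EuclideanSpace ℝ (Fin 3) →L[ℝ] EuclideanSpace ℝ (Fin 3))
      (M D₀ : ℝ≥0) (C : ℝ),
      (∀ a : ℝ, 0 < a →
        IsSuitableWeakSolutionInBall a (0 : ℝ × EuclideanSpace ℝ (Fin 3)) U P) →
      (∀ a : ℝ, 0 < a →
        HasWeakSpatialGradientOn
          (parabolicCylinderOpens a (0 : ℝ × EuclideanSpace ℝ (Fin 3))) U G) →
      (∀ a : ℝ, 0 < a →
        typeIBound (parabolicCylinder a (0 : ℝ × EuclideanSpace ℝ (Fin 3))) U P G ≤ M) →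
      (∀ z₀ : ℝ × EuclideanSpace ℝ (Fin 3), z₀.1 ≤ 0 →
        ∀ r : ℝ, 0 < r → cknD r z₀ P ≤ D₀) →
      (∀ s : ℝ, s < 0 →
        ∀ᵐ y : EuclideanSpace ℝ (Fin 3), ‖U s y‖ ≤ C / Real.sqrt (-s)) →
      (∀ φ : EuclideanSpace ℝ (Fin 3) → EuclideanSpace ℝ (Fin 3),
        ContDiff ℝ (⊤ : ℕ∞) φ →
        HasCompactSupport φ → ∀ ε : ℝ, 0 < ε →
        ∃ s₀ : ℝ, s₀ < 0 ∧ ∀ᵐ s ∂(volume.restrict (Ioo s₀ 0)), |∫ y, ⟪U s y, φ y⟫| ≤ ε) →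
      (∀ δ : ℝ, 0 < δ → ∀ R K : ℝ,
        ¬ (∀ᵐ z ∂(volume.restrict
          (Ioo (-δ) 0 ×ˢ (closedBall (0 : EuclideanSpace ℝ (Fin 3)) R)ᶜ)), ‖U z.1 z.2‖ ≤ K)) →
      ¬ IsBackwardSingularPoint U (0 : ℝ × EuclideanSpace ℝ (Fin 3)) := by
  intro U P G M D₀ C hsw hG hI hD hrate htop hspread _hsing
  obtain ⟨δ, hδ, R, hR, hC1'⟩ := hC1 U P G M D₀ C hsw hG hI hD hrate htop hspread
  -- the exterior-irrotational representatives on the sub-slabs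
  have hirr : ∀ ε : ℝ, 0 < ε → ε < δ →
      ∃ V : ℝ → EuclideanSpace ℝ (Fin 3) → EuclideanSpace ℝ (Fin 3),
        uncurry V =ᵐ[volume.restrict
          (Ioo (-δ) (-ε) ×ˢ (closedBall (0 : EuclideanSpace ℝ (Fin 3)) R)ᶜ)] uncurry U ∧
        ∀ s ∈ Ioo (-δ) (-ε),
          ContDiffOn ℝ 2 (V s) (closedBall (0 : EuclideanSpace ℝ (Fin 3)) R)ᶜ ∧
          ∀ x ∈ (closedBall (0 : EuclideanSpace ℝ (Fin 3)) R)ᶜ,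
            curl (V s) x = 0 ∧ VectorCalculus.divergence (V s) x = 0 := by
    intro ε hε hεδ
    have hb : -ε < 0 := by linarith
    obtain ⟨K, V, hVU, hVc, hCD, -, -, -, hdiv, -, -⟩ :=
      exists_strip_representative_of_apex hsw hD hrate (a := -δ) hb
    have hcurl := hC1' ε hε hεδ V hVU hVc hCD hdiv
    refine ⟨V, ae_restrict_of_ae_restrict_of_subset (prod_mono Subset.rfl (subset_univ _)) hVU,
      fun s hs => ⟨fun x _ => ?_, fun x hx => ⟨?_, hdiv (s, x) ⟨hs, mem_univ _⟩⟩⟩⟩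
    · exact ((hCD (s, x) ⟨hs, mem_univ _⟩).of_le (by norm_cast)).contDiffWithinAt
    · have hx' : R < ‖x‖ := by
        rw [mem_compl_iff, mem_closedBall_zero_iff, not_le] at hx; exact hx
      exact hcurl s hs x hx'
  obtain ⟨δ', hδ', R', K, hconf⟩ := confined_of_exterior_irrotational hI hδ hR hirr
  exact hspread δ' hδ' R' K hconf

end Summit.NavierStokesRegularity.NavierStokesRegularity.Theorems.TypeITraceScarL3

end
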